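import Mathlib

/-!
# Crux `UniformPhotonSphereChannelsR` (K1R, stmt-FinalStateConjecture-14074), line
# `crum-peeling-recessive-tower` — Theorem A support: Lemma 1 (the supersolution of the leading chain)

Theorem A (`stub_coeffMajorant`) of c1's plan (`Cruxes/UniformPhotonSphereChannelsR/NOTES.md` §§7–11)
controls the coefficient chain by the profile `Ĝ_n(B) = (2/(n−1)) θ^{1−n} B^{n−1}`; its backbone is
LEMMA 1 (§11): for the positive LEADING map `H_n = μ_λ(n) G_n + coupling_n`,
`coupling_n = (2λã/(2λ−1+n)) Q̂_{n−1}`, `Q̂_1 = Δ = (2λ−1)/(λ(λ−1))`,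
`(2λ−1+m) Q̂_m = ã(m−1) Q̂_{m−1} + ((2λ−1)(m−1)/(λ−1)) Ĝ_m`, one has
`coupling_n ≤ (θ/(1−θ))·(1 − μ_λ(n))·Ĝ_n`, `1 − μ_λ(n) = (2λ−1)(n−1)/((λ−1)(2λ−1+n))`.

This file proves it — for ALL `n ≥ 2` (no restriction to the positive regime `n ≤ 2λ−1`) and real
`λ ≥ 2`, `0 ≤ ã ≤ B`, `0 < θ < 1` — by a two-line induction instead of §11's unrolling: with
`S_m := 2(2λ−1)(B/θ)^{m−1}/((λ−1)(2λ−1+m)) = (1 − μ_λ(m)) Ĝ_m` (a hypothesis-defined sequence, no `def`) the recursion reads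
`Q̂_m = ã(m−1)Q̂_{m−1}/(2λ−1+m) + S_m`, and `Q̂_m ≤ S_m/(1−θ)` propagates because
`ã(m−1) S_{m−1} ≤ θ (2λ−1+m) S_m ⟺ ã(m−1)/(2λ−2+m) ≤ B`.  The statement takes the recursion as a
HYPOTHESIS on an arbitrary sequence `Q`, so that any definition of `Q̂` can be plugged in.
-/

-- `Summit.<S>.<S>` repeats a namespace component by design (D-0017); off here as in the lakefile.
set_option linter.dupNamespace false

noncomputable section

namespace Summit.FinalStateConjecture.FinalStateConjecture.Theorems.CrumPeelingRecessiveTower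

namespace LeadingChain

variable {lam a B θ : ℝ} {S : ℕ → ℝ}

/-! Throughout, `S : ℕ → ℝ` is the comparison sequence
`S m = 2(2λ−1)(B/θ)^{m−1}/((λ−1)(2λ−1+m))` (`= (1 − μ_λ(m)) Ĝ_m`), passed as a hypothesis `hS`
(no definition is introduced). -/

/-- `S_m` is the room `(1 − μ_λ(m)) Ĝ_m` of mode `m ≥ 2`. -/
theorem S_eq (lam B θ : ℝ) (S : ℕ → ℝ)
    (hS : ∀ m : ℕ, S m = 2 * (2 * lam - 1) * (B / θ) ^ (m - 1) / ((lam - 1) * (2 * lam - 1 + m)))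
    {m : ℕ} (hm : 2 ≤ m) :
    S m = (2 * lam - 1) * ((m : ℝ) - 1) / ((lam - 1) * (2 * lam - 1 + m))
      * (2 / ((m : ℝ) - 1) * (B / θ) ^ (m - 1)) := by
  have hm1 : (m : ℝ) - 1 ≠ 0 := by
    have : (2 : ℝ) ≤ m := by exact_mod_cast hm
    intro h; linarith
  rw [hS]
  field_simp

/-- The KEY ratio inequality: `ã c S_m ≤ θ (2λ + m) S_{m+1}` whenever `0 ≤ c ≤ 2λ − 1 + m`
(`m ≥ 1`), i.e. `ã c/(2λ−1+m) ≤ B`.  Used with `c = m` (the `Q̂`-recursion) and `c = 2λ`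
(the coupling). -/
theorem key_step (hlam : 2 ≤ lam) (ha : 0 ≤ a) (haB : a ≤ B) (hθ : 0 < θ)
    (hS : ∀ m : ℕ, S m = 2 * (2 * lam - 1) * (B / θ) ^ (m - 1) / ((lam - 1) * (2 * lam - 1 + m)))
    {m : ℕ} (hm : 1 ≤ m) {c : ℝ} (hc : 0 ≤ c) (hcm : c ≤ 2 * lam - 1 + m) :
    a * c * S m ≤ θ * (2 * lam - 1 + ((m + 1 : ℕ) : ℝ)) * S (m + 1) := by
  have hB : 0 ≤ B := ha.trans haB
  have hm' : (1 : ℝ) ≤ m := by exact_mod_cast hm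
  have hden : 0 < 2 * lam - 1 + (m : ℝ) := by linarith
  -- common factor `P = 2(2λ−1)(B/θ)^{m−1}/(λ−1) ≥ 0`
  set P : ℝ := 2 * (2 * lam - 1) * (B / θ) ^ (m - 1) / (lam - 1) with hP
  have hP0 : 0 ≤ P := by
    rw [hP]
    apply div_nonneg
    · have : 0 ≤ (B / θ) ^ (m - 1) := pow_nonneg (div_nonneg hB hθ.le) _
      nlinarith
    · linarith
  have hθne : θ ≠ 0 := hθ.ne'
  have hlne : lam - 1 ≠ 0 := by intro h; linarith
  have hl : a * c * S m = (a * c / (2 * lam - 1 + m)) * P := by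
    simp only [hS, hP]
    field_simp
  have hr : θ * (2 * lam - 1 + ((m + 1 : ℕ) : ℝ)) * S (m + 1) = B * P := by
    simp only [hS, hP, Nat.add_sub_cancel]
    have hpow : (B / θ) ^ m = (B / θ) ^ (m - 1) * (B / θ) := by
      rw [← pow_succ, Nat.sub_add_cancel hm]
    rw [hpow]
    have hden' : 2 * lam - 1 + ((m + 1 : ℕ) : ℝ) ≠ 0 := by push_cast; intro h; linarith
    field_simp
  rw [hl, hr]
  refine mul_le_mul_of_nonneg_right ?_ hP0
  rw [div_le_iff₀ hden]
  nlinarith [mul_le_mul haB hcm hc hB]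

/-- **Supersolution bound for `Q̂`**: `Q̂_m ≤ S_m/(1−θ)` for `m ≥ 2`, for every sequence `Q` obeying
`Q 1 = Δ` and the `Q̂`-recursion. -/
theorem Q_le (hlam : 2 ≤ lam) (ha : 0 ≤ a) (haB : a ≤ B) (hθ : 0 < θ) (hθ1 : θ < 1)
    (hS : ∀ m : ℕ, S m = 2 * (2 * lam - 1) * (B / θ) ^ (m - 1) / ((lam - 1) * (2 * lam - 1 + m)))
    (Q : ℕ → ℝ) (hQ1 : Q 1 = (2 * lam - 1) / (lam * (lam - 1)))
    (hrec : ∀ m : ℕ, 2 ≤ m → (2 * lam - 1 + m) * Q m = a * ((m : ℝ) - 1) * Q (m - 1)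
      + (2 * lam - 1) * ((m : ℝ) - 1) / (lam - 1) * (2 / ((m : ℝ) - 1) * (B / θ) ^ (m - 1))) :
    ∀ m : ℕ, 2 ≤ m → Q m ≤ S m / (1 - θ) := by
  have hB : 0 ≤ B := ha.trans haB
  have h1θ : 0 < 1 - θ := by linarith
  have hlne : lam - 1 ≠ 0 := by intro h; linarith
  have hθne : θ ≠ 0 := hθ.ne'
  -- the recursion in `S`-form
  have hQS : ∀ m : ℕ, 2 ≤ m →
      Q m = a * ((m : ℝ) - 1) * Q (m - 1) / (2 * lam - 1 + m) + S m := by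
    intro m hm
    have hm' : (2 : ℝ) ≤ m := by exact_mod_cast hm
    have hden : (2 * lam - 1 + (m : ℝ)) ≠ 0 := by intro h; linarith
    have hm1 : (m : ℝ) - 1 ≠ 0 := by intro h; linarith
    have h := hrec m hm
    have hgoal : (2 * lam - 1 + m) * Q m
        = (2 * lam - 1 + m) * (a * ((m : ℝ) - 1) * Q (m - 1) / (2 * lam - 1 + m) + S m) := by
      rw [h, hS]
      field_simp
    exact mul_left_cancel₀ hden hgoal
  -- nonnegativity of `S`
  have hS0 : ∀ m : ℕ, 0 ≤ S m := by
    intro m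
    rw [hS]
    apply div_nonneg
    · have : 0 ≤ (B / θ) ^ (m - 1) := pow_nonneg (div_nonneg hB hθ.le) _
      nlinarith
    · have : (0 : ℝ) ≤ m := Nat.cast_nonneg m
      nlinarith
  intro m hm
  induction m, hm using Nat.le_induction with
  | base =>
    rw [hQS 2 le_rfl, hQ1]
    -- `a Δ/(2λ+1) ≤ θ S₂/(1−θ)`: both sides carry the factor `F = (2λ−1)/((λ−1)(2λ+1))`
    set F : ℝ := (2 * lam - 1) / ((lam - 1) * (2 * lam + 1)) with hF
    have hF0 : 0 ≤ F := by rw [hF]; apply div_nonneg <;> nlinarith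
    have hlam0 : lam ≠ 0 := by intro h; linarith
    have h2l1 : 2 * lam + 1 ≠ 0 := by intro h; linarith
    have h2l1' : 2 * lam - 1 + 2 ≠ 0 := by intro h; linarith
    have e1 : a * (((2 : ℕ) : ℝ) - 1) * ((2 * lam - 1) / (lam * (lam - 1))) / (2 * lam - 1 + ((2 : ℕ) : ℝ))
        = F * (a / lam) := by
      rw [hF]; push_cast; field_simp; ring
    have e2 : S 2 / (1 - θ) = S 2 + F * (2 * B / (1 - θ)) := by
      rw [hF, hS]
      simp only [show (2 : ℕ) - 1 = 1 from rfl, pow_one]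
      push_cast
      have : (1 - θ) ≠ 0 := h1θ.ne'
      field_simp
      ring
    rw [e1, e2]
    have hkey : a / lam ≤ 2 * B / (1 - θ) := by
      rw [div_le_div_iff₀ (by linarith) h1θ]
      nlinarith [mul_nonneg ha hθ.le, mul_nonneg hB (by linarith : (0 : ℝ) ≤ lam - 1)]
    nlinarith [mul_le_mul_of_nonneg_left hkey hF0]
  | succ m hm ih =>
    rw [hQS (m + 1) (by omega)]
    simp only [Nat.add_sub_cancel]
    have hm1 : (1 : ℕ) ≤ m := by omega
    have hmr : (2 : ℝ) ≤ m := by exact_mod_cast hm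
    have hden : 0 < 2 * lam - 1 + ((m + 1 : ℕ) : ℝ) := by push_cast; linarith
    have hcast : ((m + 1 : ℕ) : ℝ) - 1 = m := by push_cast; ring
    rw [hcast]
    -- monotonicity in `Q m`, then the key step with `c = m`
    have ham : 0 ≤ a * (m : ℝ) := by positivity
    have h1 : a * (m : ℝ) * Q m / (2 * lam - 1 + ((m + 1 : ℕ) : ℝ))
        ≤ a * (m : ℝ) * (S m / (1 - θ)) / (2 * lam - 1 + ((m + 1 : ℕ) : ℝ)) :=
      div_le_div_of_nonneg_right (mul_le_mul_of_nonneg_left ih ham) hden.le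
    have hkey := key_step hlam ha haB hθ hS hm1 (Nat.cast_nonneg m) (by linarith : (m : ℝ) ≤ 2 * lam - 1 + m)
    have h2 : a * (m : ℝ) * (S m / (1 - θ)) / (2 * lam - 1 + ((m + 1 : ℕ) : ℝ))
        ≤ θ * S (m + 1) / (1 - θ) := by
      rw [div_le_div_iff₀ hden h1θ]
      have := mul_le_mul_of_nonneg_right hkey h1θ.le
      calc a * (m : ℝ) * (S m / (1 - θ)) * (1 - θ) = a * (m : ℝ) * S m := by
            field_simp
        _ ≤ θ * (2 * lam - 1 + ((m + 1 : ℕ) : ℝ)) * S (m + 1) := hkey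
        _ = θ * S (m + 1) * (2 * lam - 1 + ((m + 1 : ℕ) : ℝ)) := by ring
    have h3 : θ * S (m + 1) / (1 - θ) + S (m + 1) = S (m + 1) / (1 - θ) := by
      field_simp
      ring
    linarith

end LeadingChain

open LeadingChain

/-- **Lemma 1 — the supersolution of the leading chain** (registered sub-goal
`coeffMajorant_leadingSupersolution` of `stub_coeffMajorant`, verbatim signature; c1's plan §11 / A2,
here for every `n ≥ 2`).  For real `λ ≥ 2`, `0 ≤ ã ≤ B`, `0 < θ < 1` and any sequence `Q` with
`Q 1 = (2λ−1)/(λ(λ−1))` and `(2λ−1+m) Q m = ã(m−1) Q (m−1) + ((2λ−1)(m−1)/(λ−1))·Ĝ_m` (`m ≥ 2`,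
`Ĝ_m = (2/(m−1))(B/θ)^{m−1}`):
`(2λã/(2λ−1+n))·Q (n−1) ≤ (θ/(1−θ))·((2λ−1)(n−1)/((λ−1)(2λ−1+n)))·Ĝ_n`. -/
theorem coeffMajorant_leadingSupersolution : ∀ (lam a B θ : ℝ) (Q : ℕ → ℝ), 2 ≤ lam → 0 ≤ a → a ≤ B → 0 < θ → θ < 1 → Q 1 = (2 * lam - 1) / (lam * (lam - 1)) → (∀ m : ℕ, 2 ≤ m → (2 * lam - 1 + m) * Q m = a * ((m : ℝ) - 1) * Q (m - 1) + (2 * lam - 1) * ((m : ℝ) - 1) / (lam - 1) * (2 / ((m : ℝ) - 1) * (B / θ) ^ (m - 1))) → ∀ n : ℕ, 2 ≤ n → 2 * lam * a / (2 * lam - 1 + n) * Q (n - 1) ≤ θ / (1 - θ) * ((2 * lam - 1) * ((n : ℝ) - 1) / ((lam - 1) * (2 * lam - 1 + n))) * (2 / ((n : ℝ) - 1) * (B / θ) ^ (n - 1)) := by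
  intro lam a B θ Q hlam ha haB hθ hθ1 hQ1 hrec n hn
  -- the comparison sequence, as a local function with its defining equation
  obtain ⟨S, hS⟩ : ∃ S : ℕ → ℝ,
      ∀ m : ℕ, S m = 2 * (2 * lam - 1) * (B / θ) ^ (m - 1) / ((lam - 1) * (2 * lam - 1 + m)) :=
    ⟨fun m => 2 * (2 * lam - 1) * (B / θ) ^ (m - 1) / ((lam - 1) * (2 * lam - 1 + m)), fun m => rfl⟩
  have hB : 0 ≤ B := ha.trans haB
  have h1θ : 0 < 1 - θ := by linarith
  have hlne : lam - 1 ≠ 0 := by intro h; linarith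
  have hlam0 : lam ≠ 0 := by intro h; linarith
  have hθne : θ ≠ 0 := hθ.ne'
  rw [mul_assoc (θ / (1 - θ)), ← S_eq lam B θ S hS hn]
  rcases Nat.lt_or_ge n 3 with h2 | h3
  · -- `n = 2`: directly
    obtain rfl : n = 2 := by omega
    rw [hQ1]
    set F : ℝ := (2 * lam - 1) / ((lam - 1) * (2 * lam + 1)) with hF
    have hF0 : 0 ≤ F := by rw [hF]; apply div_nonneg <;> nlinarith
    have h2l1 : 2 * lam + 1 ≠ 0 := by intro h; linarith
    have h2l1' : 2 * lam - 1 + 2 ≠ 0 := by intro h; linarith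
    have e1 : 2 * lam * a / (2 * lam - 1 + ((2 : ℕ) : ℝ)) * ((2 * lam - 1) / (lam * (lam - 1)))
        = F * (2 * a) := by
      rw [hF]; push_cast; field_simp; ring
    have e2 : θ / (1 - θ) * S 2 = F * (2 * B / (1 - θ)) := by
      rw [hF, hS]
      simp only [show (2 : ℕ) - 1 = 1 from rfl, pow_one]
      push_cast
      have : (1 - θ) ≠ 0 := h1θ.ne'
      field_simp
      ring
    rw [e1, e2]
    have hkey : 2 * a ≤ 2 * B / (1 - θ) := by
      rw [le_div_iff₀ h1θ]
      nlinarith [mul_nonneg ha hθ.le]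
    exact mul_le_mul_of_nonneg_left hkey hF0
  · -- `n ≥ 3`: the `Q̂`-bound at `n − 1 ≥ 2` and the key step with `c = 2λ`
    have hQ := Q_le hlam ha haB hθ hθ1 hS Q hQ1 hrec (n - 1) (by omega)
    have hn1 : (1 : ℕ) ≤ n - 1 := by omega
    have hnr : (3 : ℝ) ≤ n := by exact_mod_cast h3
    have hden : 0 < 2 * lam - 1 + (n : ℝ) := by linarith
    have hkey := key_step hlam ha haB hθ hS hn1 (by linarith : (0 : ℝ) ≤ 2 * lam)
      (by
        have : ((n - 1 : ℕ) : ℝ) = n - 1 := by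
          rw [Nat.cast_sub (by omega)]; push_cast; ring
        rw [this]; linarith)
    rw [Nat.sub_add_cancel (by omega : 1 ≤ n)] at hkey
    -- assemble
    have hnum : 0 ≤ 2 * lam * a := by positivity
    calc 2 * lam * a / (2 * lam - 1 + n) * Q (n - 1)
        ≤ 2 * lam * a / (2 * lam - 1 + n) * (S (n - 1) / (1 - θ)) :=
          mul_le_mul_of_nonneg_left hQ (div_nonneg hnum hden.le)
      _ = (a * (2 * lam) * S (n - 1)) / ((2 * lam - 1 + n) * (1 - θ)) := by
          field_simp
      _ ≤ (θ * (2 * lam - 1 + n) * S n) / ((2 * lam - 1 + n) * (1 - θ)) :=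
          div_le_div_of_nonneg_right hkey (by positivity)
      _ = θ / (1 - θ) * S n := by
          field_simp

end Summit.FinalStateConjecture.FinalStateConjecture.Theorems.CrumPeelingRecessiveTower

end
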